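import Mathlib
import Summits.ValiantsHypothesis.ValiantsHypothesis.Theses.SummationBits

/-!
# Route SummationBits — `RyserToThesis` (item stmt-ValiantsHypothesis-7567)

Glue lemma of route SummationBits: `RyserOptimalDepth3 → SPSNormalForm → Depth3Thesis`.

Given the constant `c₀` of `RyserOptimalDepth3` and a thesis constant `c`, a product-depth-≤1 circuit
computing `per_n` with `E ≤ (n+2)^(c⌊√n⌋+c)` wires is normalised by `SPSNormalForm` into an affine ΣΠΣ
expression with `r = D = E + 1`, so `RyserOptimalDepth3` gives `2^n ≤ (E+1)(E+2)(n+2)^c₀`; but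
`(E+1)(E+2)(n+2)^c₀ ≤ 6 B² (n+2)^c₀ ≤ (n+2)^(2c⌊√n⌋ + 2c + c₀ + 3) < 2^n` for a suitable `n`
(`B = (n+2)^(c⌊√n⌋+c)`), the elementary growth comparison `2^(O(√n log n)) = o(2^n)`, realised here
at `n = 4^m` where `⌊√n⌋ = 2^m` exactly.

No literature is needed beyond the route file; the comparison is elementary arithmetic.
-/

namespace Summit.ValiantsHypothesis.ValiantsHypothesis.Theorems

open Summit.ValiantsHypothesis.ValiantsHypothesis.Theses.SummationBits

/-- For every `K` there is an `m` with `2 (m+1) K < 2^m` (witness `m = 3 (K+3)`). -/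
theorem ryserToThesis_exists_linear_lt_two_pow (K : ℕ) : ∃ m : ℕ, 2 * (m + 1) * K < 2 ^ m := by
  refine ⟨3 * (K + 3), ?_⟩
  set t : ℕ := K + 3 with ht
  have hKt : K ≤ t := by omega
  have h3t : 3 ≤ t := by omega
  have htpow : t < 2 ^ t := Nat.lt_two_pow_self
  have h8 : 8 ≤ 2 ^ t :=
    calc (8 : ℕ) = 2 ^ 3 := by norm_num
      _ ≤ 2 ^ t := Nat.pow_le_pow_right (by norm_num) h3t
  have hsplit : 2 ^ (3 * t) = 2 ^ t * (2 ^ t * 2 ^ t) := by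
    rw [← pow_add, ← pow_add]; ring_nf
  rw [hsplit]
  have htt : t * t < 2 ^ t * 2 ^ t := Nat.mul_lt_mul'' htpow htpow
  calc 2 * (3 * t + 1) * K ≤ 8 * (t * t) := by nlinarith [hKt, h3t]
    _ ≤ 2 ^ t * (t * t) := Nat.mul_le_mul_right _ h8
    _ < 2 ^ t * (2 ^ t * 2 ^ t) := Nat.mul_lt_mul_of_pos_left htt (by positivity)

/-- Elementary growth comparison: for all `a b` there is `n ≥ 1` with `(n+2)^(a⌊√n⌋+b) < 2^n`
(witness `n = 4^m = 2^m · 2^m` with `2 (m+1) (a+b) < 2^m`, where `⌊√n⌋ = 2^m`). -/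
theorem ryserToThesis_growth (a b : ℕ) :
    ∃ n : ℕ, 1 ≤ n ∧ (n + 2) ^ (a * Nat.sqrt n + b) < 2 ^ n := by
  obtain ⟨m, hm⟩ := ryserToThesis_exists_linear_lt_two_pow (a + b)
  set s : ℕ := 2 ^ m with hs
  have hs1 : 1 ≤ s := Nat.one_le_two_pow
  refine ⟨s * s, Nat.mul_le_mul hs1 hs1, ?_⟩
  rw [Nat.sqrt_eq s]
  -- n + 2 ≤ 4 n = 2^(2m+2)
  have hn2 : s * s + 2 ≤ 2 ^ (2 * m + 2) := by
    have : 2 ^ (2 * m + 2) = 4 * (s * s) := by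
      rw [hs, ← pow_add]; ring_nf
    rw [this]
    have : 1 ≤ s * s := Nat.mul_le_mul hs1 hs1
    omega
  -- the exponent: (2m+2)(a s + b) ≤ 2(m+1)(a+b) s < 2^m s = s s
  have hexp : (2 * m + 2) * (a * s + b) < s * s := by
    calc (2 * m + 2) * (a * s + b) ≤ (2 * m + 2) * (a * s + b * s) := by
          apply Nat.mul_le_mul_left
          exact Nat.add_le_add_left (Nat.le_mul_of_pos_right b hs1) _
      _ = 2 * (m + 1) * (a + b) * s := by ring
      _ < 2 ^ m * s := Nat.mul_lt_mul_of_pos_right hm hs1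
      _ = s * s := by rw [hs]
  calc (s * s + 2) ^ (a * s + b) ≤ (2 ^ (2 * m + 2)) ^ (a * s + b) :=
        Nat.pow_le_pow_left hn2 _
    _ = 2 ^ ((2 * m + 2) * (a * s + b)) := by rw [← pow_mul]
    _ < 2 ^ (s * s) := Nat.pow_lt_pow_right (by norm_num) hexp

/-- **Route SummationBits, item stmt-ValiantsHypothesis-7567 (`RyserToThesis`).**
`RyserOptimalDepth3 → SPSNormalForm → Depth3Thesis`: a product-depth-≤1 circuit for `per_n` with
`E ≤ (n+2)^(c⌊√n⌋+c)` wires gives, through `SPSNormalForm`, an affine ΣΠΣ expression with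
`r (D+1) = (E+1)(E+2)`, and `RyserOptimalDepth3` then forces `2^n ≤ (E+1)(E+2)(n+2)^c₀`, which fails
for the `n` supplied by `ryserToThesis_growth (2c) (2c+c₀+3)`. -/
theorem ryserToThesis_proof : RyserToThesis := by
  unfold RyserToThesis RyserOptimalDepth3 SPSNormalForm Depth3Thesis
  rintro ⟨c₀, hc₀⟩ hS c
  obtain ⟨n, hn1, hlt⟩ := ryserToThesis_growth (2 * c) (2 * c + c₀ + 3)
  refine ⟨n, fun P hP hd => ?_⟩
  by_contra hle
  push Not at hle
  obtain ⟨ℓ, hℓ, hsum⟩ := hS n P hP hd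
  have h2n := hc₀ n hn1 (P.edgeSize + 1) (P.edgeSize + 1) ℓ hℓ hsum
  -- abbreviations
  set E : ℕ := P.edgeSize with hE
  set k : ℕ := c * Nat.sqrt n + c with hk
  set B : ℕ := (n + 2) ^ k with hB
  have hB1 : 1 ≤ B := Nat.one_le_pow _ _ (by omega)
  have hN3 : 6 ≤ (n + 2) ^ 3 := by
    calc (6 : ℕ) ≤ 2 ^ 3 := by norm_num
      _ ≤ (n + 2) ^ 3 := Nat.pow_le_pow_left (by omega) 3
  have hbound : (E + 1) * (E + 1 + 1) * (n + 2) ^ c₀ < 2 ^ n :=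
    calc (E + 1) * (E + 1 + 1) * (n + 2) ^ c₀
        ≤ (B + 1) * (B + 1 + 1) * (n + 2) ^ c₀ := by gcongr
      _ ≤ 6 * (B * B) * (n + 2) ^ c₀ := by
          apply Nat.mul_le_mul_right
          nlinarith [hB1]
      _ ≤ (n + 2) ^ 3 * (B * B) * (n + 2) ^ c₀ := by gcongr
      _ = (n + 2) ^ (2 * c * Nat.sqrt n + (2 * c + c₀ + 3)) := by
          rw [hB, ← pow_add, ← pow_add, ← pow_add, hk]; ring_nf
      _ < 2 ^ n := hlt
  exact absurd h2n (not_le.mpr hbound)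

end Summit.ValiantsHypothesis.ValiantsHypothesis.Theorems
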